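import Summits.FinalStateConjecture.FinalStateConjecture.Theorems.EIHFluxBalanceInertialRecessionVirialShell
import Summits.FinalStateConjecture.FinalStateConjecture.Theorems.EIHFluxBalanceInertialRecessionVirialSmooth

/-!
# Route EIHFluxBalance — crux `InertialRecession`, abstract endgame for general `N`:
# LEMMA C — a linearly isolated, sublinearly confined class is cold

Helper file for the crux `stmt-FinalStateConjecture-10166` (virial route; `InertialRecession_seat0_session8_note.md` §A,
`InertialRecession_endgame_generalN_virial.md`). Mathlib-only. Under the literal hypotheses of the line stub
`stub_pairwiseDichotomy`, for a class `𝒦` of bodies that is LINEARLY ISOLATED (outsiders at distance `≥ σt`) and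
SUBLINEARLY CONFINED (diameter `o(t)`):

* `internalEnergy_nonneg` — `K = Σ Mⱼγⱼ − √(M_𝒦² + ‖P_𝒦‖²) ≥ 0`;
* `tendsto_charges_of_isolated_class` — the class energy `E_𝒦(t)` and momentum `P_𝒦(t)` converge (window law on
  the root window `(ξ_{x₀}(t), c₁t)` + identification, as in `Endgame.exists_tendsto_velocity_of_isolated`);
* `tendsto_velocity_of_isolated_class` — **LEMMA C**: every `vⱼ`, `j ∈ 𝒦`, converges, to the common cold velocity:
  `K → K∞` by the above, `K∞ ≤ 0` by the virial inequality (`virial_inequality_of_windows`) and the Tauberian lemma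
  (`tauberian_nonpos_of_virial_junk'`, with `|G| ≤ ΓM_𝒦·diam = o(t)` and `K ≤ (2Γ⁸/M_𝒦)σ₂`, `internalEnergy_le'`),
  `K∞ ≥ 0`, hence `K → 0` and `tendsto_velocity_of_internalEnergy_tendsto_zero'` applies;
* `pairwiseDichotomy_of_confined` — COROLLARY (THEOREM V, confined case): if ALL pairs are sublinearly confined then
  all velocities converge to one vector, so the conclusion of `stub_pairwiseDichotomy` holds.
-/

noncomputable section

open Finset Filter Topology MeasureTheory intervalIntegral

namespace Summit.FinalStateConjecture.FinalStateConjecture.Theorems.SublinearIsFree.Virial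

open Literature.Geometry.Lorentzian

variable {N : ℕ}

/-- **The internal energy is nonnegative**: `√(M_s² + ‖Σpⱼ‖²) ≤ Σ Mⱼγⱼ` for `pⱼ = Mⱼγⱼvⱼ`. [folklore] -/
theorem internalEnergy_nonneg {ι : Type*} (s : Finset ι) (M : ι → ℝ) (v : ι → E3) (hM : ∀ i ∈ s, 0 < M i)
    (hs : s.Nonempty) (hv : ∀ i ∈ s, ‖v i‖ < 1) :
    0 ≤ ∑ j ∈ s, M j * (√(1 - ‖v j‖ ^ 2))⁻¹ -
      √((∑ i ∈ s, M i) ^ 2 + ‖∑ i ∈ s, (M i * (√(1 - ‖v i‖ ^ 2))⁻¹) • v i‖ ^ 2) := by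
  have h := internalEnergy_ge' s M (fun j ↦ (M j * (√(1 - ‖v j‖ ^ 2))⁻¹) • v j) hM hs
  have hE : ∀ j ∈ s, √((M j) ^ 2 + ‖(M j * (√(1 - ‖v j‖ ^ 2))⁻¹) • v j‖ ^ 2) = M j * (√(1 - ‖v j‖ ^ 2))⁻¹ :=
    fun j hj ↦ sqrt_sq_add_norm_lorentzMomentum (hM j hj).le (hv j hj)
  rw [Finset.sum_congr rfl hE] at h
  refine le_trans (Finset.sum_nonneg fun j _ ↦ ?_) h
  positivity

/-- **Charges of a linearly isolated, sublinearly confined class converge.** Along the root window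
`(ξ_{x₀}(t), c₁ t)`, `c₁ = min ((κ−κ²)/2, σ/2)`, test scale `ρ = √t`, clearance `δ = 1/2`, the window law makes the four
charges Cauchy (`Endgame.exists_tendsto_charge_of_linear_scale`) and the identification (members `= 𝒦` eventually)
transfers the limits to `E_𝒦 = Σ_{𝒦} Mⱼγⱼ` and `P_𝒦 = Σ_{𝒦} Mⱼγⱼvⱼ`. [folklore] -/
theorem tendsto_charges_of_isolated_class (M : Fin N → ℝ) (ξ v : Fin N → ℝ → E3) (κ : ℝ)
    (P : ℝ → E3 → ℝ → Fin 4 → ℝ) (hκ0 : 0 < κ) (hκ1 : κ < 1)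
    (hξ : ∀ i, ContDiff ℝ ((⊤ : ℕ∞) : WithTop ℕ∞) (ξ i))
    (hcone : ∀ i, ∀ᶠ t in atTop, ‖ξ i t‖ ≤ κ ^ 2 * t)
    (hk : ∃ k : ℝ, 0 ≤ k ∧ k < 1 ∧ ∀ i t, ‖v i t‖ ≤ k)
    (hslave : ∀ i, Tendsto (fun t ↦ deriv (ξ i) t - v i t) atTop (𝓝 0))
    (hWL : ∀ ρ : ℝ → ℝ, Tendsto ρ atTop atTop → ∀ δ : ℝ, 0 < δ → δ < 1 → ∃ (C T : ℝ),
      ∀ (t₁ t₂ : ℝ) (c : ℝ → E3) (R : ℝ → ℝ), T ≤ t₁ → t₁ ≤ t₂ →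
      (∀ s ∈ Set.Icc t₁ t₂, ∀ s' ∈ Set.Icc t₁ t₂, ‖c s - c s'‖ ≤ 2 * |s - s'| ∧ |R s - R s'| ≤ 2 * |s - s'|) →
      (∀ s ∈ Set.Icc t₁ t₂, ρ s ≤ δ * R s ∧ ‖c s‖ + R s ≤ (κ + κ ^ 2) / 2 * s ∧
        ∀ j, ‖ξ j s - c s‖ ≤ (1 - δ) * R s ∨ (1 + δ) * R s ≤ ‖ξ j s - c s‖) →
      ∀ μ : Fin 4, |P t₂ (c t₂) (R t₂) μ - P t₁ (c t₁) (R t₁) μ| ≤ C * ∫ s in t₁..t₂, (R s ^ (3 / 2 : ℝ))⁻¹)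
    (hID : ∀ ρ : ℝ → ℝ, Tendsto ρ atTop atTop → ∀ δ : ℝ, 0 < δ → δ < 1 → ∃ (T : ℝ) (ζ : ℝ → ℝ),
      Tendsto ζ atTop (𝓝 0) ∧ ∀ (t : ℝ) (c : E3) (R : ℝ) (A : Finset (Fin N)), T ≤ t → ρ t ≤ δ * R →
      ‖c‖ + R ≤ (κ + κ ^ 2) / 2 * t → (∀ j, ‖ξ j t - c‖ ≤ (1 - δ) * R ∨ (1 + δ) * R ≤ ‖ξ j t - c‖) →
      (∀ j, j ∈ A ↔ ‖ξ j t - c‖ ≤ (1 - δ) * R) →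
      |P t c R 0 - ∑ j ∈ A, M j * (√(1 - ‖v j t‖ ^ 2))⁻¹| ≤ ζ t ∧
      ∀ k : Fin 3, |P t c R k.succ - ∑ j ∈ A, M j * (√(1 - ‖v j t‖ ^ 2))⁻¹ * v j t k| ≤ ζ t)
    (𝒦 : Finset (Fin N)) {x₀ : Fin N} (hx₀ : x₀ ∈ 𝒦) {σ : ℝ} (hσ : 0 < σ)
    (hiso : ∀ᶠ t in atTop, ∀ x ∈ 𝒦, ∀ z ∉ 𝒦, σ * t ≤ ‖ξ z t - ξ x t‖)
    (hconf : ∀ η : ℝ, 0 < η → ∀ᶠ t in atTop, ∀ x ∈ 𝒦, ∀ y ∈ 𝒦, ‖ξ x t - ξ y t‖ ≤ η * t) :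
    ∃ (Einf : ℝ) (Pinf : E3), Tendsto (fun t ↦ ∑ j ∈ 𝒦, M j * (√(1 - ‖v j t‖ ^ 2))⁻¹) atTop (𝓝 Einf) ∧
      Tendsto (fun t ↦ ∑ j ∈ 𝒦, (M j * (√(1 - ‖v j t‖ ^ 2))⁻¹) • v j t) atTop (𝓝 Pinf) := by
  obtain ⟨k, -, hk1, hvk⟩ := hk
  -- constants of the root window
  set c₁ : ℝ := min ((κ - κ ^ 2) / 2) (σ / 2) with hc₁
  have hκκ : 0 < κ - κ ^ 2 := by nlinarith
  have hc₁pos : 0 < c₁ := lt_min (by linarith) (by linarith)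
  have hc₁le : c₁ ≤ (κ - κ ^ 2) / 2 := min_le_left _ _
  have hc₁σ : c₁ ≤ σ / 2 := min_le_right _ _
  have hc₁two : c₁ ≤ 2 := by
    have : (κ - κ ^ 2) / 2 ≤ 2 := by nlinarith
    exact hc₁le.trans this
  -- the window law and identification at threshold `ρ = √t`, clearance `δ = 1/2`
  have hρ : Tendsto (fun t : ℝ ↦ √t) atTop atTop := by
    have := tendsto_rpow_atTop (show (0 : ℝ) < 1 / 2 by norm_num)
    refine this.congr' ?_
    filter_upwards [eventually_ge_atTop 0] with t ht
    rw [Real.sqrt_eq_rpow]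
  obtain ⟨C, T_W, hW⟩ := hWL (fun t ↦ √t) hρ (1 / 2) (by norm_num) (by norm_num)
  obtain ⟨T_I, ζ, hζ, hI⟩ := hID (fun t ↦ √t) hρ (1 / 2) (by norm_num) (by norm_num)
  -- eventual facts, turned into thresholds
  have hdiff : Differentiable ℝ (ξ x₀) := (hξ x₀).differentiable (by simp)
  have hev_speed : ∀ᶠ t in atTop, ‖deriv (ξ x₀) t‖ ≤ 2 := by
    have h1 : ∀ᶠ t in atTop, ‖deriv (ξ x₀) t - v x₀ t‖ < 1 := by
      have := (tendsto_iff_norm_sub_tendsto_zero.mp (hslave x₀))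
      simp only [sub_zero] at this
      exact this.eventually (gt_mem_nhds (by norm_num))
    filter_upwards [h1] with t ht
    calc ‖deriv (ξ x₀) t‖ = ‖(deriv (ξ x₀) t - v x₀ t) + v x₀ t‖ := by rw [sub_add_cancel]
      _ ≤ ‖deriv (ξ x₀) t - v x₀ t‖ + ‖v x₀ t‖ := norm_add_le _ _
      _ ≤ 1 + k := by linarith [hvk x₀ t, ht.le]
      _ ≤ 2 := by linarith
  have hev_sqrt : ∀ᶠ t : ℝ in atTop, √t ≤ 1 / 2 * (c₁ * t) := by
    filter_upwards [eventually_ge_atTop (4 / c₁ ^ 2), eventually_ge_atTop (0 : ℝ)] with t ht ht0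
    have hc2 : 0 < c₁ ^ 2 := by positivity
    have ht' : 4 ≤ c₁ ^ 2 * t := by
      have := (div_le_iff₀ hc2).mp ht
      linarith
    have hy : 0 ≤ 1 / 2 * (c₁ * t) := by positivity
    have hle : t ≤ (1 / 2 * (c₁ * t)) ^ 2 := by nlinarith
    calc √t ≤ √((1 / 2 * (c₁ * t)) ^ 2) := Real.sqrt_le_sqrt hle
      _ = 1 / 2 * (c₁ * t) := Real.sqrt_sq hy
  have hev_conf : ∀ᶠ t in atTop, ∀ x ∈ 𝒦, ∀ y ∈ 𝒦, ‖ξ x t - ξ y t‖ ≤ c₁ / 2 * t := hconf (c₁ / 2) (by positivity)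
  obtain ⟨T₀, hT₀⟩ := eventually_atTop.mp (((((hcone x₀).and hev_speed).and hev_sqrt).and hiso).and hev_conf)
  -- the master threshold
  set T : ℝ := max (max (max T₀ T_W) T_I) 1 with hTdef
  have hT0 : T₀ ≤ T := ((le_max_left _ _).trans (le_max_left _ _)).trans (le_max_left _ _)
  have hTW : T_W ≤ T := ((le_max_right _ _).trans (le_max_left _ _)).trans (le_max_left _ _)
  have hTI : T_I ≤ T := (le_max_right _ _).trans (le_max_left _ _)
  have hT1 : 1 ≤ T := le_max_right _ _
  have hTpos : 0 < T := one_pos.trans_le hT1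
  have hfacts : ∀ t, T ≤ t → ‖ξ x₀ t‖ ≤ κ ^ 2 * t ∧ ‖deriv (ξ x₀) t‖ ≤ 2 ∧ √t ≤ 1 / 2 * (c₁ * t) ∧
      (∀ x ∈ 𝒦, ∀ z ∉ 𝒦, σ * t ≤ ‖ξ z t - ξ x t‖) ∧ (∀ x ∈ 𝒦, ∀ y ∈ 𝒦, ‖ξ x t - ξ y t‖ ≤ c₁ / 2 * t) :=
    fun t ht ↦ by
    obtain ⟨⟨⟨⟨h1, h2⟩, h3⟩, h4⟩, h5⟩ := hT₀ t (hT0.trans ht)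
    exact ⟨h1, h2, h3, h4, h5⟩
  -- admissibility of the root window `(ξ x₀ t, c₁ t)` at every `t ≥ T`
  have hadm : ∀ t, T ≤ t → √t ≤ 1 / 2 * (c₁ * t) ∧ ‖ξ x₀ t‖ + c₁ * t ≤ (κ + κ ^ 2) / 2 * t ∧
      ∀ j, ‖ξ j t - ξ x₀ t‖ ≤ (1 - 1 / 2) * (c₁ * t) ∨ (1 + 1 / 2) * (c₁ * t) ≤ ‖ξ j t - ξ x₀ t‖ := by
    intro t ht
    obtain ⟨hc, -, hs, hiso', hconf'⟩ := hfacts t ht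
    have htpos : 0 < t := hTpos.trans_le ht
    refine ⟨hs, ?_, fun j ↦ ?_⟩
    · have : c₁ * t ≤ (κ - κ ^ 2) / 2 * t := mul_le_mul_of_nonneg_right hc₁le htpos.le
      linarith
    · by_cases hj : j ∈ 𝒦
      · left
        have := hconf' j hj x₀ hx₀
        linarith
      · right
        have h1 : (1 + 1 / 2) * (c₁ * t) ≤ σ * t := by
          have h2 : c₁ * t ≤ σ / 2 * t := mul_le_mul_of_nonneg_right hc₁σ htpos.le
          have h3 : 0 ≤ σ * t := (mul_pos hσ htpos).le
          nlinarith
        exact h1.trans (hiso' x₀ hx₀ j hj)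
  -- the charge along the window path and the window law along it
  set Q : ℝ → Fin 4 → ℝ := fun t μ ↦ P t (ξ x₀ t) (c₁ * t) μ with hQ
  have hlaw : ∀ t₁ t₂, T ≤ t₁ → t₁ ≤ t₂ → ∀ μ, |Q t₂ μ - Q t₁ μ| ≤
      C * ∫ s in t₁..t₂, ((c₁ * s) ^ (3 / 2 : ℝ))⁻¹ := by
    intro t₁ t₂ ht₁ h12 μ
    refine hW t₁ t₂ (ξ x₀) (fun s ↦ c₁ * s) (hTW.trans ht₁) h12 (fun s hs s' hs' ↦ ⟨?_, ?_⟩) ?_ μ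
    · exact Endgame.lipschitz_two_of_deriv hdiff (fun t ht ↦ (hfacts t ht).2.1) (ht₁.trans hs.1) (ht₁.trans hs'.1)
    · rw [← mul_sub, abs_mul, abs_of_pos hc₁pos]
      exact mul_le_mul_of_nonneg_right hc₁two (abs_nonneg _)
    · intro s hs
      exact hadm s (ht₁.trans hs.1)
  have hconv : ∀ μ, ∃ L : ℝ, Tendsto (fun t ↦ Q t μ) atTop (𝓝 L) :=
    Endgame.exists_tendsto_charge_of_linear_scale (R := fun s ↦ c₁ * s) hTpos hc₁pos
      ((continuous_const.mul continuous_id).continuousOn) (fun s _ ↦ le_rfl) hlaw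
  -- identification with the class `𝒦`
  have hmem : ∀ t, T ≤ t → ∀ j, j ∈ 𝒦 ↔ ‖ξ j t - ξ x₀ t‖ ≤ (1 - 1 / 2) * (c₁ * t) := by
    intro t ht j
    obtain ⟨-, -, -, hiso', hconf'⟩ := hfacts t ht
    have htpos : 0 < t := hTpos.trans_le ht
    constructor
    · intro hj
      have := hconf' j hj x₀ hx₀
      linarith
    · intro hle
      by_contra hj
      have h1 := hiso' x₀ hx₀ j hj
      have h2 : c₁ * t ≤ σ / 2 * t := mul_le_mul_of_nonneg_right hc₁σ htpos.le
      have h3 : 0 < σ * t := mul_pos hσ htpos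
      linarith
  have hid : ∀ t, T ≤ t → |Q t 0 - ∑ j ∈ 𝒦, M j * (√(1 - ‖v j t‖ ^ 2))⁻¹| ≤ ζ t ∧
      ∀ kk : Fin 3, |Q t kk.succ - ∑ j ∈ 𝒦, M j * (√(1 - ‖v j t‖ ^ 2))⁻¹ * v j t kk| ≤ ζ t := by
    intro t ht
    obtain ⟨hs, hcone', hclear⟩ := hadm t ht
    have h := hI t (ξ x₀ t) (c₁ * t) 𝒦 (hTI.trans ht) hs hcone' hclear (hmem t ht)
    simpa [hQ] using h
  choose L hL using hconv
  have hE : Tendsto (fun t ↦ ∑ j ∈ 𝒦, M j * (√(1 - ‖v j t‖ ^ 2))⁻¹) atTop (𝓝 (L 0)) :=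
    Endgame.tendsto_of_abs_sub_le_of_tendsto (hL 0) hζ fun t ht ↦ (hid t ht).1
  have hPk : ∀ i : Fin 3, Tendsto (fun t ↦ ∑ j ∈ 𝒦, M j * (√(1 - ‖v j t‖ ^ 2))⁻¹ * v j t i) atTop (𝓝 (L i.succ)) :=
    fun i ↦ Endgame.tendsto_of_abs_sub_le_of_tendsto (hL i.succ) hζ fun t ht ↦ (hid t ht).2 i
  let Pinf : E3 := WithLp.toLp 2 fun i ↦ L i.succ
  refine ⟨L 0, Pinf, hE, Endgame.tendsto_euclidean_of_forall_apply fun i ↦ ?_⟩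
  have h1 : (fun t ↦ (∑ j ∈ 𝒦, (M j * (√(1 - ‖v j t‖ ^ 2))⁻¹) • v j t) i) =
      fun t ↦ ∑ j ∈ 𝒦, M j * (√(1 - ‖v j t‖ ^ 2))⁻¹ * v j t i := by
    ext t
    simp only [WithLp.ofLp_sum, Finset.sum_apply, PiLp.smul_apply, smul_eq_mul]
  rw [h1]
  simpa [Pinf] using hPk i

/-- **LEMMA C — a linearly isolated, sublinearly confined class is cold**: under the hypotheses of
`stub_pairwiseDichotomy`, if `𝒦` (`|𝒦| ≥ 2`) has all outsiders at distance `≥ σt` and diameter `o(t)`, then all the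
velocities `vⱼ`, `j ∈ 𝒦`, converge to ONE vector (the cold velocity of the limiting class momentum). Virial route:
`virial_inequality_of_windows` + `tauberian_nonpos_of_virial_junk'` + `internalEnergy_le'`/`internalEnergy_nonneg` +
`tendsto_velocity_of_internalEnergy_tendsto_zero'`. [folklore] -/
theorem tendsto_velocity_of_isolated_class (M : Fin N → ℝ) (ξ v : Fin N → ℝ → E3) (κ : ℝ)
    (P : ℝ → E3 → ℝ → Fin 4 → ℝ) (hM : ∀ i, 0 < M i) (hκ0 : 0 < κ) (hκ1 : κ < 1)
    (hξ : ∀ i, ContDiff ℝ ((⊤ : ℕ∞) : WithTop ℕ∞) (ξ i))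
    (hcone : ∀ i, ∀ᶠ t in atTop, ‖ξ i t‖ ≤ κ ^ 2 * t)
    (hsep : ∀ i j, i ≠ j → Tendsto (fun t ↦ ‖ξ i t - ξ j t‖) atTop atTop) (hvc : ∀ i, Continuous (v i))
    (hk : ∃ k : ℝ, 0 ≤ k ∧ k < 1 ∧ ∀ i t, ‖v i t‖ ≤ k)
    (hslave : ∀ i, Tendsto (fun t ↦ deriv (ξ i) t - v i t) atTop (𝓝 0))
    (hWL : ∀ ρ : ℝ → ℝ, Tendsto ρ atTop atTop → ∀ δ : ℝ, 0 < δ → δ < 1 → ∃ (C T : ℝ),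
      ∀ (t₁ t₂ : ℝ) (c : ℝ → E3) (R : ℝ → ℝ), T ≤ t₁ → t₁ ≤ t₂ →
      (∀ s ∈ Set.Icc t₁ t₂, ∀ s' ∈ Set.Icc t₁ t₂, ‖c s - c s'‖ ≤ 2 * |s - s'| ∧ |R s - R s'| ≤ 2 * |s - s'|) →
      (∀ s ∈ Set.Icc t₁ t₂, ρ s ≤ δ * R s ∧ ‖c s‖ + R s ≤ (κ + κ ^ 2) / 2 * s ∧
        ∀ j, ‖ξ j s - c s‖ ≤ (1 - δ) * R s ∨ (1 + δ) * R s ≤ ‖ξ j s - c s‖) →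
      ∀ μ : Fin 4, |P t₂ (c t₂) (R t₂) μ - P t₁ (c t₁) (R t₁) μ| ≤ C * ∫ s in t₁..t₂, (R s ^ (3 / 2 : ℝ))⁻¹)
    (hID : ∀ ρ : ℝ → ℝ, Tendsto ρ atTop atTop → ∀ δ : ℝ, 0 < δ → δ < 1 → ∃ (T : ℝ) (ζ : ℝ → ℝ),
      Tendsto ζ atTop (𝓝 0) ∧ ∀ (t : ℝ) (c : E3) (R : ℝ) (A : Finset (Fin N)), T ≤ t → ρ t ≤ δ * R →
      ‖c‖ + R ≤ (κ + κ ^ 2) / 2 * t → (∀ j, ‖ξ j t - c‖ ≤ (1 - δ) * R ∨ (1 + δ) * R ≤ ‖ξ j t - c‖) →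
      (∀ j, j ∈ A ↔ ‖ξ j t - c‖ ≤ (1 - δ) * R) →
      |P t c R 0 - ∑ j ∈ A, M j * (√(1 - ‖v j t‖ ^ 2))⁻¹| ≤ ζ t ∧
      ∀ k : Fin 3, |P t c R k.succ - ∑ j ∈ A, M j * (√(1 - ‖v j t‖ ^ 2))⁻¹ * v j t k| ≤ ζ t)
    (𝒦 : Finset (Fin N)) (h𝒦 : 2 ≤ 𝒦.card) {σ : ℝ} (hσ : 0 < σ)
    (hiso : ∀ᶠ t in atTop, ∀ x ∈ 𝒦, ∀ z ∉ 𝒦, σ * t ≤ ‖ξ z t - ξ x t‖)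
    (hconf : ∀ η : ℝ, 0 < η → ∀ᶠ t in atTop, ∀ x ∈ 𝒦, ∀ y ∈ 𝒦, ‖ξ x t - ξ y t‖ ≤ η * t) :
    ∃ V : E3, ∀ j ∈ 𝒦, Tendsto (v j) atTop (𝓝 V) := by
  classical
  obtain ⟨x₀, hx₀⟩ : 𝒦.Nonempty := Finset.card_pos.mp (by omega)
  have hne : 𝒦.Nonempty := ⟨x₀, hx₀⟩
  obtain ⟨k, hk0, hk1, hvk⟩ := id hk
  have hMK : 0 < ∑ i ∈ 𝒦, M i := Finset.sum_pos (fun i _ ↦ hM i) hne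
  have hk2 : 0 < 1 - k ^ 2 := by nlinarith
  have hv1 : ∀ i t, ‖v i t‖ < 1 := fun i t ↦ (hvk i t).trans_lt hk1
  have hΓ : ∀ i t, (√(1 - ‖v i t‖ ^ 2))⁻¹ ≤ (√(1 - k ^ 2))⁻¹ := fun i t ↦ by
    refine inv_anti₀ (Real.sqrt_pos.mpr hk2) (Real.sqrt_le_sqrt ?_)
    nlinarith [hvk i t, norm_nonneg (v i t)]
  -- 1. the class charges converge, hence so does the internal energy `K`
  obtain ⟨Einf, Pinf, hE, hP⟩ :=
    tendsto_charges_of_isolated_class M ξ v κ P hκ0 hκ1 hξ hcone hk hslave hWL hID 𝒦 hx₀ hσ hiso hconf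
  have hKt : Tendsto (fun t ↦ ∑ j ∈ 𝒦, M j * (√(1 - ‖v j t‖ ^ 2))⁻¹ -
      √((∑ i ∈ 𝒦, M i) ^ 2 + ‖∑ i ∈ 𝒦, (M i * (√(1 - ‖v i t‖ ^ 2))⁻¹) • v i t‖ ^ 2)) atTop
      (𝓝 (Einf - √((∑ i ∈ 𝒦, M i) ^ 2 + ‖Pinf‖ ^ 2))) :=
    hE.sub (((hP.norm.pow 2).const_add _).sqrt)
  -- 2. the virial inequality for the (eventually `1`-gapped) root `𝒦`
  have hroot : ∀ᶠ t in atTop, ∃ D G : ℝ, (∀ x ∈ 𝒦, ∀ y ∈ 𝒦, ‖ξ x t - ξ y t‖ ≤ D) ∧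
      (∀ x ∈ 𝒦, ∀ z ∈ univ \ 𝒦, G ≤ ‖ξ x t - ξ z t‖) ∧ 1 * D < G := by
    filter_upwards [hiso, hconf (σ / 2) (by positivity), eventually_gt_atTop 0] with t hi hc ht
    refine ⟨σ / 2 * t, σ * t, hc, fun x hx z hz ↦ ?_, ?_⟩
    · rw [norm_sub_rev]; exact hi x hx z (Finset.mem_sdiff.mp hz).2
    · have := mul_pos hσ ht
      linarith
  obtain ⟨h, CJ, T₂, ε, hh, hCJ, hεa, hεt, hvir⟩ :=
    virial_inequality_of_windows M ξ v κ P hM hκ0 hκ1 hξ hcone hsep hvc hk hslave hWL hID 𝒦 h𝒦 hroot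
  -- 3. the diameter, the lever bound `|G| ≤ A·diam`, named functions
  have hne2 : (𝒦 ×ˢ 𝒦).Nonempty := hne.product hne
  obtain ⟨diam, hdiam⟩ : ∃ d : ℝ → ℝ, ∀ t, d t = (𝒦 ×ˢ 𝒦).sup' hne2 (fun p ↦ ‖ξ p.1 t - ξ p.2 t‖) :=
    ⟨_, fun _ ↦ rfl⟩
  have hdle : ∀ t, ∀ x ∈ 𝒦, ∀ y ∈ 𝒦, ‖ξ x t - ξ y t‖ ≤ diam t := fun t x hx y hy ↦ by
    rw [hdiam]
    exact Finset.le_sup' (fun p : Fin N × Fin N ↦ ‖ξ p.1 t - ξ p.2 t‖) (b := (x, y)) (Finset.mem_product.mpr ⟨hx, hy⟩)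
  have hd0 : ∀ t, 0 ≤ diam t := fun t ↦ (norm_nonneg _).trans (hdle t x₀ hx₀ x₀ hx₀)
  have hdsmall : ∀ η : ℝ, 0 < η → ∀ᶠ t in atTop, diam t ≤ η * t := fun η hη ↦ by
    filter_upwards [hconf η hη] with t ht
    rw [hdiam]
    exact Finset.sup'_le _ _ fun p hp ↦ ht p.1 (Finset.mem_product.mp hp).1 p.2 (Finset.mem_product.mp hp).2
  obtain ⟨A, hAdef⟩ : ∃ A : ℝ, A = max 1 ((∑ i ∈ 𝒦, M i) * (√(1 - k ^ 2))⁻¹) := ⟨_, rfl⟩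
  have hA1 : 1 ≤ A := hAdef ▸ le_max_left _ _
  have hAΓ : (∑ i ∈ 𝒦, M i) * (√(1 - k ^ 2))⁻¹ ≤ A := hAdef ▸ le_max_right _ _
  have hA0 : 0 < A := one_pos.trans_le hA1
  obtain ⟨G, hGdef⟩ : ∃ G : ℝ → ℝ, ∀ t, G t = ∑ j ∈ 𝒦, inner ℝ ((M j * (√(1 - ‖v j t‖ ^ 2))⁻¹) • v j t)
      (ξ j t - (∑ l ∈ 𝒦, M l)⁻¹ • ∑ l ∈ 𝒦, M l • ξ l t) := ⟨_, fun _ ↦ rfl⟩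
  obtain ⟨σ₂, hσdef⟩ : ∃ σ₂ : ℝ → ℝ, ∀ t, σ₂ t = ∑ j ∈ 𝒦, ∑ l ∈ 𝒦, M j * M l * ‖v j t - v l t‖ ^ 2 :=
    ⟨_, fun _ ↦ rfl⟩
  have hσc : Continuous σ₂ := by
    rw [show σ₂ = fun t ↦ ∑ j ∈ 𝒦, ∑ l ∈ 𝒦, M j * M l * ‖v j t - v l t‖ ^ 2 from funext hσdef]
    exact continuous_finsetSum _ fun j _ ↦ continuous_finsetSum _ fun l _ ↦
      continuous_const.mul (((hvc j).sub (hvc l)).norm.pow 2)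
  have hGle : ∀ t, |G t| ≤ A * diam t := by
    intro t
    rw [hGdef]
    refine (Finset.abs_sum_le_sum_abs _ _).trans ?_
    have hterm : ∀ j ∈ 𝒦, |inner ℝ ((M j * (√(1 - ‖v j t‖ ^ 2))⁻¹) • v j t)
        (ξ j t - (∑ l ∈ 𝒦, M l)⁻¹ • ∑ l ∈ 𝒦, M l • ξ l t)| ≤ M j * (√(1 - k ^ 2))⁻¹ * diam t := by
      intro j hj
      refine (abs_real_inner_le_norm _ _).trans ?_
      have hγ0 : 0 < (√(1 - ‖v j t‖ ^ 2))⁻¹ :=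
        inv_pos.mpr (Real.sqrt_pos.mpr (by nlinarith [hv1 j t, norm_nonneg (v j t)]))
      have h1 : ‖(M j * (√(1 - ‖v j t‖ ^ 2))⁻¹) • v j t‖ ≤ M j * (√(1 - k ^ 2))⁻¹ := by
        rw [norm_smul, Real.norm_eq_abs, abs_of_pos (mul_pos (hM j) hγ0)]
        calc M j * (√(1 - ‖v j t‖ ^ 2))⁻¹ * ‖v j t‖ ≤ M j * (√(1 - ‖v j t‖ ^ 2))⁻¹ * 1 :=
              mul_le_mul_of_nonneg_left (hv1 j t).le (mul_pos (hM j) hγ0).le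
          _ ≤ M j * (√(1 - k ^ 2))⁻¹ := by
              rw [mul_one]; exact mul_le_mul_of_nonneg_left (hΓ j t) (hM j).le
      have h2 : ‖ξ j t - (∑ l ∈ 𝒦, M l)⁻¹ • ∑ l ∈ 𝒦, M l • ξ l t‖ ≤ diam t :=
        norm_sub_centre_le (ξ := fun i ↦ ξ i t) (M := M) (S := 𝒦) (A := 𝒦) hM subset_rfl hne hj (hdle t)
      exact mul_le_mul h1 h2 (norm_nonneg _) (mul_pos (hM j) (inv_pos.mpr (Real.sqrt_pos.mpr hk2))).le
    refine (Finset.sum_le_sum hterm).trans ?_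
    rw [← Finset.sum_mul, ← Finset.sum_mul]
    exact mul_le_mul_of_nonneg_right hAΓ (hd0 t)
  -- 4. the Tauberian step: `K∞ ≤ 0`
  have hKinf : Einf - √((∑ i ∈ 𝒦, M i) ^ 2 + ‖Pinf‖ ^ 2) ≤ 0 := by
    refine tauberian_nonpos_of_virial_junk' (G := G) (D := fun t ↦ A * diam t) (σ₂ := σ₂) (ε := ε)
      (c := (2 * ∑ i ∈ 𝒦, M i)⁻¹) (C := 2 * ((√(1 - k ^ 2))⁻¹) ^ 8 / ∑ i ∈ 𝒦, M i) (CJ := CJ) (T₀ := T₂)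
      (by positivity) (by positivity) hCJ (fun t _ ↦ hGle t) ?_ (fun a b ↦ hσc.intervalIntegrable a b)
      (fun a b ↦ hεa.intervalIntegrable) hεt ?_ ?_ hKt
    · intro η hη
      filter_upwards [hdsmall (η / A) (by positivity)] with t ht
      show A * diam t ≤ η * t
      calc A * diam t ≤ A * (η / A * t) := mul_le_mul_of_nonneg_left ht hA0.le
        _ = η * t := by field_simp
    · intro T hT
      refine ⟨h, hh, fun n ↦ ?_⟩
      have hv := hvir T hT n (diam (T + n * h)) (hd0 _) (hdle _)
      rw [← hGdef (T + n * h), ← hGdef T] at hv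
      have hσ : (∫ s in T..(T + n * h), ∑ j ∈ 𝒦, ∑ l ∈ 𝒦, M j * M l * ‖v j s - v l s‖ ^ 2) =
          ∫ s in T..(T + n * h), σ₂ s := by simp only [hσdef]
      rw [hσ] at hv
      show (2 * ∑ i ∈ 𝒦, M i)⁻¹ * (∫ t in T..(T + n * h), σ₂ t) - (∫ t in T..(T + n * h), ε t) -
          CJ * (1 + A * diam (T + n * h)) ≤ G (T + n * h) - G T
      have hj : CJ * diam (T + n * h) ≤ CJ * (1 + A * diam (T + n * h)) := by
        refine mul_le_mul_of_nonneg_left ?_ hCJ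
        nlinarith [hd0 (T + n * h), hA1]
      linarith
    · intro t _
      show ∑ j ∈ 𝒦, M j * (√(1 - ‖v j t‖ ^ 2))⁻¹ -
          √((∑ i ∈ 𝒦, M i) ^ 2 + ‖∑ i ∈ 𝒦, (M i * (√(1 - ‖v i t‖ ^ 2))⁻¹) • v i t‖ ^ 2) ≤
        2 * ((√(1 - k ^ 2))⁻¹) ^ 8 / (∑ i ∈ 𝒦, M i) * σ₂ t
      rw [hσdef]
      exact internalEnergy_le' 𝒦 M (fun j ↦ v j t) (fun i _ ↦ hM i) hk1 (fun i _ ↦ hvk i t) hne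
  -- 5. `K∞ ≥ 0`, so `K → 0`, and the cold limit
  have hKinf0 : 0 ≤ Einf - √((∑ i ∈ 𝒦, M i) ^ 2 + ‖Pinf‖ ^ 2) :=
    ge_of_tendsto' hKt fun t ↦ internalEnergy_nonneg 𝒦 M (fun j ↦ v j t) (fun i _ ↦ hM i) hne fun i _ ↦ hv1 i t
  have hK0 : Tendsto (fun t ↦ ∑ j ∈ 𝒦, M j * (√(1 - ‖v j t‖ ^ 2))⁻¹ -
      √((∑ i ∈ 𝒦, M i) ^ 2 + ‖∑ i ∈ 𝒦, (M i * (√(1 - ‖v i t‖ ^ 2))⁻¹) • v i t‖ ^ 2)) atTop (𝓝 0) := by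
    have h0 : Einf - √((∑ i ∈ 𝒦, M i) ^ 2 + ‖Pinf‖ ^ 2) = 0 := le_antisymm hKinf hKinf0
    rwa [h0] at hKt
  exact ⟨(√((∑ i ∈ 𝒦, M i) ^ 2 + ‖Pinf‖ ^ 2))⁻¹ • Pinf, fun j hj ↦
    tendsto_velocity_of_internalEnergy_tendsto_zero' 𝒦 M v (fun i _ ↦ hM i) hk0 hk1 (fun i _ t ↦ hvk i t) hP hK0 hj⟩

/-- **COROLLARY (THEOREM V, confined case).** Under the hypotheses of `stub_pairwiseDichotomy`, if ALL pairs are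
sublinearly confined (`‖ξᵢ − ξⱼ‖ = o(t)`), then all velocities converge to one vector; in particular the stub's
dichotomy holds (second alternative for every pair). [folklore] -/
theorem pairwiseDichotomy_of_confined (M : Fin N → ℝ) (ξ v : Fin N → ℝ → E3) (κ : ℝ)
    (P : ℝ → E3 → ℝ → Fin 4 → ℝ) (hM : ∀ i, 0 < M i) (hκ0 : 0 < κ) (hκ1 : κ < 1)
    (hξ : ∀ i, ContDiff ℝ ((⊤ : ℕ∞) : WithTop ℕ∞) (ξ i))
    (hcone : ∀ i, ∀ᶠ t in atTop, ‖ξ i t‖ ≤ κ ^ 2 * t)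
    (hsep : ∀ i j, i ≠ j → Tendsto (fun t ↦ ‖ξ i t - ξ j t‖) atTop atTop) (hvc : ∀ i, Continuous (v i))
    (hk : ∃ k : ℝ, 0 ≤ k ∧ k < 1 ∧ ∀ i t, ‖v i t‖ ≤ k)
    (hslave : ∀ i, Tendsto (fun t ↦ deriv (ξ i) t - v i t) atTop (𝓝 0))
    (hWL : ∀ ρ : ℝ → ℝ, Tendsto ρ atTop atTop → ∀ δ : ℝ, 0 < δ → δ < 1 → ∃ (C T : ℝ),
      ∀ (t₁ t₂ : ℝ) (c : ℝ → E3) (R : ℝ → ℝ), T ≤ t₁ → t₁ ≤ t₂ →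
      (∀ s ∈ Set.Icc t₁ t₂, ∀ s' ∈ Set.Icc t₁ t₂, ‖c s - c s'‖ ≤ 2 * |s - s'| ∧ |R s - R s'| ≤ 2 * |s - s'|) →
      (∀ s ∈ Set.Icc t₁ t₂, ρ s ≤ δ * R s ∧ ‖c s‖ + R s ≤ (κ + κ ^ 2) / 2 * s ∧
        ∀ j, ‖ξ j s - c s‖ ≤ (1 - δ) * R s ∨ (1 + δ) * R s ≤ ‖ξ j s - c s‖) →
      ∀ μ : Fin 4, |P t₂ (c t₂) (R t₂) μ - P t₁ (c t₁) (R t₁) μ| ≤ C * ∫ s in t₁..t₂, (R s ^ (3 / 2 : ℝ))⁻¹)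
    (hID : ∀ ρ : ℝ → ℝ, Tendsto ρ atTop atTop → ∀ δ : ℝ, 0 < δ → δ < 1 → ∃ (T : ℝ) (ζ : ℝ → ℝ),
      Tendsto ζ atTop (𝓝 0) ∧ ∀ (t : ℝ) (c : E3) (R : ℝ) (A : Finset (Fin N)), T ≤ t → ρ t ≤ δ * R →
      ‖c‖ + R ≤ (κ + κ ^ 2) / 2 * t → (∀ j, ‖ξ j t - c‖ ≤ (1 - δ) * R ∨ (1 + δ) * R ≤ ‖ξ j t - c‖) →
      (∀ j, j ∈ A ↔ ‖ξ j t - c‖ ≤ (1 - δ) * R) →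
      |P t c R 0 - ∑ j ∈ A, M j * (√(1 - ‖v j t‖ ^ 2))⁻¹| ≤ ζ t ∧
      ∀ k : Fin 3, |P t c R k.succ - ∑ j ∈ A, M j * (√(1 - ‖v j t‖ ^ 2))⁻¹ * v j t k| ≤ ζ t)
    (hconf : ∀ (i j : Fin N) (η : ℝ), 0 < η → ∀ᶠ t in atTop, ‖ξ i t - ξ j t‖ ≤ η * t) (i j : Fin N) :
    (∃ σ : ℝ, 0 < σ ∧ ∀ᶠ t in atTop, σ * t ≤ ‖ξ j t - ξ i t‖) ∨
      Tendsto (fun t ↦ v j t - v i t) atTop (𝓝 0) := by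
  right
  by_cases hij : i = j
  · subst hij
    simp
  have h2 : 2 ≤ (univ : Finset (Fin N)).card := Finset.one_lt_card.mpr ⟨i, mem_univ _, j, mem_univ _, hij⟩
  have hiso : ∀ᶠ t : ℝ in atTop, ∀ x ∈ (univ : Finset (Fin N)), ∀ z ∉ (univ : Finset (Fin N)),
      1 * t ≤ ‖ξ z t - ξ x t‖ := Eventually.of_forall fun t x _ z hz ↦ absurd (mem_univ z) hz
  have hconf' : ∀ η : ℝ, 0 < η → ∀ᶠ t in atTop, ∀ x ∈ (univ : Finset (Fin N)), ∀ y ∈ (univ : Finset (Fin N)),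
      ‖ξ x t - ξ y t‖ ≤ η * t := fun η hη ↦ by
    have hall : ∀ᶠ t in atTop, ∀ x y : Fin N, ‖ξ x t - ξ y t‖ ≤ η * t :=
      Filter.eventually_all.mpr fun x ↦ Filter.eventually_all.mpr fun y ↦ hconf x y η hη
    exact hall.mono fun t ht x _ y _ ↦ ht x y
  obtain ⟨V, hV⟩ := tendsto_velocity_of_isolated_class M ξ v κ P hM hκ0 hκ1 hξ hcone hsep hvc hk hslave hWL hID
    univ h2 one_pos hiso hconf'
  simpa using (hV j (mem_univ _)).sub (hV i (mem_univ _))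

/-- Registered one-line form of `internalEnergy_nonneg`. [folklore] -/
theorem internalEnergy_nonneg' : open Literature.Geometry.Lorentzian Finset in ∀ {ι : Type*} (s : Finset ι) (M : ι → ℝ) (v : ι → E3), (∀ i ∈ s, 0 < M i) → s.Nonempty → (∀ i ∈ s, ‖v i‖ < 1) → 0 ≤ ∑ j ∈ s, M j * (√(1 - ‖v j‖ ^ 2))⁻¹ - √((∑ i ∈ s, M i) ^ 2 + ‖∑ i ∈ s, (M i * (√(1 - ‖v i‖ ^ 2))⁻¹) • v i‖ ^ 2) :=
  fun s M v hM hs hv ↦ internalEnergy_nonneg s M v hM hs hv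

end Summit.FinalStateConjecture.FinalStateConjecture.Theorems.SublinearIsFree.Virial

end
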